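import Mathlib
import HarnessLib
import Summits.HubbardSuperconductivity.HubbardSuperconductivity.Theorems.KLProgrammeH10TwoPointLimitKlAnisoAbsUmklappCount
import Summits.HubbardSuperconductivity.HubbardSuperconductivity.Theorems.KLProgrammeKLRegimeSplitOnWindow

/-!
# Route `KLProgramme` — K3 engine child `KLRegimeEngineV17F2` (stmt-HubbardSuperconductivity-20437), stub (b) (ℓ)/(I2)–(I3), located item «ABS-UMK-COUNT»:
# the keyed ABSOLUTE count (exponent `(m+1) − |E| − 2`, umklapp strings included) ON EVERY ADMISSIBLE FRAME IN THE KL REGIME and on `klWindowC`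

Cell gate-hubbard-kl, seat p4 g16.  `card_absCount_prescribed_klAniso_le_frame` / `card_relCount_prescribed_absUmklapp_klAniso_le_frame`
(`…KlAnisoAbsUmklappCount`) read in the stub-(b) binders of k3c2-p3's jump lemmas — `FrameOK Rc U (nScales β) ν K`, `0 < c ≤ c₃`, `0 < U ≤ U₀`,
`klBetaMin ≤ β ≤ e^{c/U²}` — with `D` fixed BEFORE `m` and `Rc` (drop-in twins of `EngineV8.card_relCount_prescribed_lastLeg_klAniso_le(_window)`, p4 g11,
with one more conservation gain when `|E| + 5 ≤ m + 1`):
* `card_absCount_prescribed_klAniso_le_frameOK` — the plain prescribed filter `σ″|_E = τ″|_E`;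
* `card_relCount_prescribed_absUmklapp_klAniso_le_frameOK` — the literal `hcnt` filter (refinement of a coarse `σ′` of any scale `k`, same spin/charge);
* `card_relCount_prescribed_absUmklapp_klAniso_le_window` — the same on the covariance window `klWindowC = [-1.05, -0.15]`.
Everything is PROVED; no definitions, no named facts; nothing here asserts anything about the model or superconductivity.
References: BGM 2006 §2.7–§2.8, App. A3 [cite: BenfattoGiulianiMastropietro2006]; BGM 2003 §3.1 Lemma 3.1 (4.3), §7.4 [cite: BenfattoGiulianiMastropietro2003].
-/

noncomputable section

namespace Summit.HubbardSuperconductivity.HubbardSuperconductivity.Theorems.PerturbedFermiCurve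

set_option linter.dupNamespace false -- summit = problem name (single-conjunct summit), D-0017

open Classical
open Real Set Finset
open Literature.MathematicalPhysics.QuantumLattice Literature.MathematicalPhysics.QuantumLattice.BandSectorCounting
open Literature.MathematicalPhysics.QuantumLattice.FermiRG Literature.MathematicalPhysics.QuantumLattice.FermiRG.BGM2003
open Literature.Probability.LatticeModels
open Summit.HubbardSuperconductivity.HubbardSuperconductivity.Theorems.DispersionFlow
open Summit.HubbardSuperconductivity.HubbardSuperconductivity.Theorems.KLRegimeSplit
open Summit.HubbardSuperconductivity.HubbardSuperconductivity.Theorems.KLProgrammeLegKernels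
open Summit.HubbardSuperconductivity.HubbardSuperconductivity.Theorems.TorusFourierL2

/-- **The keyed absolute count (plain prescribed filter) ON EVERY ADMISSIBLE FRAME IN THE KL REGIME** (`D` before `m` and `Rc`).
[cite: BenfattoGiulianiMastropietro2006, App. A3 Lemma A3.1; BenfattoGiulianiMastropietro2003, §3.1 Lemma 3.1 (4.3), §7.4] -/
theorem card_absCount_prescribed_klAniso_le_frameOK :
    ∀ μ₁ μ₂ : ℝ, -4 < μ₁ - 4 * klE0 → μ₁ ≤ μ₂ → μ₂ + 4 * klE0 < 0 → ∃ D : ℝ, 0 < D ∧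
      ∀ Rc : RenConsts, (∀ j, 0 ≤ Rc.Gfr j) → ∃ c₃ : ℝ, 0 < c₃ ∧ ∃ U₀ : ℝ, 0 < U₀ ∧
      ∀ c : ℝ, 0 < c → c ≤ c₃ → ∀ U : ℝ, 0 < U → U ≤ U₀ → ∀ β : ℝ, klBetaMin ≤ β → β ≤ Real.exp (c / U ^ 2) →
      ∀ μ ∈ Set.Icc μ₁ μ₂, ∀ (ν : ℝ) (K : TrigPolyC4v), FrameOK Rc U (nScales β) ν K →
      ∀ (L M : ℕ) [NeZero L] (m J' : ℕ),
      ∀ (A'' : Finset (Fin (m + 1) → SectorLeg (sectorCount J'))),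
        A'' ⊆ bgmSectorSet L M (klAnisoFamily L M β μ K klE0 J') (m + 1) →
      ∀ (E : Finset (Fin (m + 1))) (τ'' : Fin (m + 1) → SectorLeg (sectorCount J')), E.card + 5 ≤ m + 1 →
      ((((A''.filter fun σ'' => ∀ e ∈ E, σ'' e = τ'' e).card : ℕ) : ℝ)) ≤
        D ^ (m + 1) * ((2 : ℝ) ^ J') ^ ((m + 1) - E.card - 2) := by
  intro μ₁ μ₂ hμ₁ h12 hμ₂
  obtain ⟨κ, hκ, D, hD, h⟩ := card_absCount_prescribed_klAniso_le_frame μ₁ μ₂ hμ₁ h12 hμ₂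
  refine ⟨D, hD, fun Rc hR => ?_⟩
  obtain ⟨c₃, hc₃, U₀, hU₀, hthr⟩ := frame_thresholds hR hκ
  refine ⟨c₃, hc₃, U₀, hU₀, ?_⟩
  intro c hc hcle U hU hUle β hβmin hβc μ hμ ν K hK L M _ m J' A'' hA'' E τ'' hE
  exact h K _ (fun q j hj => norm_iteratedFDeriv_frameShift_le_of_frameOK_regime hR hc.le hβmin hβc hK q hj)
    (hthr c U hc.le hcle hU hUle) μ hμ L M β m J' A'' hA'' E τ'' hE

/-- **The keyed absolute count for the literal `hcnt` filter ON EVERY ADMISSIBLE FRAME IN THE KL REGIME** (`D` before `m` and `Rc`; drop-in twin of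
`EngineV8.card_relCount_prescribed_lastLeg_klAniso_le` with exponent `(m+1) − |E| − 2` when `|E| + 5 ≤ m + 1`).
[cite: BenfattoGiulianiMastropietro2006, §2.8 (2.82)-(2.84), App. A3 Lemma A3.1; BenfattoGiulianiMastropietro2003, §3.1 Lemma 3.1 (4.3), §7.4] -/
theorem card_relCount_prescribed_absUmklapp_klAniso_le_frameOK :
    ∀ μ₁ μ₂ : ℝ, -4 < μ₁ - 4 * klE0 → μ₁ ≤ μ₂ → μ₂ + 4 * klE0 < 0 → ∃ D : ℝ, 0 < D ∧
      ∀ Rc : RenConsts, (∀ j, 0 ≤ Rc.Gfr j) → ∃ c₃ : ℝ, 0 < c₃ ∧ ∃ U₀ : ℝ, 0 < U₀ ∧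
      ∀ c : ℝ, 0 < c → c ≤ c₃ → ∀ U : ℝ, 0 < U → U ≤ U₀ → ∀ β : ℝ, klBetaMin ≤ β → β ≤ Real.exp (c / U ^ 2) →
      ∀ μ ∈ Set.Icc μ₁ μ₂, ∀ (ν : ℝ) (K : TrigPolyC4v), FrameOK Rc U (nScales β) ν K →
      ∀ (L M : ℕ) [NeZero L] (m k J' : ℕ),
      ∀ (A'' : Finset (Fin (m + 1) → SectorLeg (sectorCount J'))),
        A'' ⊆ bgmSectorSet L M (klAnisoFamily L M β μ K klE0 J') (m + 1) →
      ∀ (E : Finset (Fin (m + 1))) (τ'' : Fin (m + 1) → SectorLeg (sectorCount J')) (σ' : Fin (m + 1) → SectorLeg (sectorCount k)),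
        E.card + 5 ≤ m + 1 →
      (((A''.filter fun σ'' => (∀ e ∈ E, σ'' e = τ'' e) ∧ ∀ i,
        (∃ q : FreqMomentum L M, klAnisoFamily L M β μ K klE0 J' (σ'' i).1.1 q ≠ 0 ∧
          bgmFatMultiplier L M klE0 β (nambuXiCT L μ K) k (σ' i).1.1 q ≠ 0) ∧
        (σ' i).1.2 = (σ'' i).1.2 ∧ (σ' i).2 = (σ'' i).2).card : ℝ)) ≤
        D ^ (m + 1) * ((2 : ℝ) ^ J') ^ ((m + 1) - E.card - 2) := by
  intro μ₁ μ₂ hμ₁ h12 hμ₂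
  obtain ⟨κ, hκ, D, hD, h⟩ := card_relCount_prescribed_absUmklapp_klAniso_le_frame μ₁ μ₂ hμ₁ h12 hμ₂
  refine ⟨D, hD, fun Rc hR => ?_⟩
  obtain ⟨c₃, hc₃, U₀, hU₀, hthr⟩ := frame_thresholds hR hκ
  refine ⟨c₃, hc₃, U₀, hU₀, ?_⟩
  intro c hc hcle U hU hUle β hβmin hβc μ hμ ν K hK L M _ m k J' A'' hA'' E τ'' σ' hE
  exact h K _ (fun q j hj => norm_iteratedFDeriv_frameShift_le_of_frameOK_regime hR hc.le hβmin hβc hK q hj)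
    (hthr c U hc.le hcle hU hUle) μ hμ L M β m k J' A'' hA'' E τ'' σ' hE

/-- **The keyed absolute count for the literal `hcnt` filter on the covariance window `klWindowC`** (`D` absolute; regime thresholds per `Rc`).
[cite: BenfattoGiulianiMastropietro2006, §2.8 (2.82)-(2.84), App. A3 Lemma A3.1; BenfattoGiulianiMastropietro2003, §3.1 Lemma 3.1 (4.3), §7.4] -/
theorem card_relCount_prescribed_absUmklapp_klAniso_le_window :
    ∃ D : ℝ, 0 < D ∧
      ∀ Rc : RenConsts, (∀ j, 0 ≤ Rc.Gfr j) → ∃ c₃ : ℝ, 0 < c₃ ∧ ∃ U₀ : ℝ, 0 < U₀ ∧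
      ∀ c : ℝ, 0 < c → c ≤ c₃ → ∀ U : ℝ, 0 < U → U ≤ U₀ → ∀ β : ℝ, klBetaMin ≤ β → β ≤ Real.exp (c / U ^ 2) →
      ∀ μ ∈ klWindowC, ∀ (ν : ℝ) (K : TrigPolyC4v), FrameOK Rc U (nScales β) ν K →
      ∀ (L M : ℕ) [NeZero L] (m k J' : ℕ),
      ∀ (A'' : Finset (Fin (m + 1) → SectorLeg (sectorCount J'))),
        A'' ⊆ bgmSectorSet L M (klAnisoFamily L M β μ K klE0 J') (m + 1) →
      ∀ (E : Finset (Fin (m + 1))) (τ'' : Fin (m + 1) → SectorLeg (sectorCount J')) (σ' : Fin (m + 1) → SectorLeg (sectorCount k)),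
        E.card + 5 ≤ m + 1 →
      (((A''.filter fun σ'' => (∀ e ∈ E, σ'' e = τ'' e) ∧ ∀ i,
        (∃ q : FreqMomentum L M, klAnisoFamily L M β μ K klE0 J' (σ'' i).1.1 q ≠ 0 ∧
          bgmFatMultiplier L M klE0 β (nambuXiCT L μ K) k (σ' i).1.1 q ≠ 0) ∧
        (σ' i).1.2 = (σ'' i).1.2 ∧ (σ' i).2 = (σ'' i).2).card : ℝ)) ≤
        D ^ (m + 1) * ((2 : ℝ) ^ J') ^ ((m + 1) - E.card - 2) :=
  card_relCount_prescribed_absUmklapp_klAniso_le_frameOK (-1.05) (-0.15) (by norm_num [klE0]) (by norm_num) (by norm_num [klE0])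

end Summit.HubbardSuperconductivity.HubbardSuperconductivity.Theorems.PerturbedFermiCurve

end
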